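import Literature.AlgebraicGeometry.Hironaka2017.Proofs.S09LLUED.Lem95CoupledCountermodel
import Literature.AlgebraicGeometry.Hironaka2017.Proofs.S09LLUED.TopFrontierDepthWitness
import HarnessLib

/-!
# The SW carrier has standard expressions of EVERY depth: `E = Σ_{r < 2^{ℓ−1}} ω₂ · (ω₁^r ω₂)² · U_ℓ`,
# `U_ℓ = (Σ_j ω₁^j)^{2^ℓ}` (kill tests K2.4 / K2.5, slots W2.4 / W2.5; GAP row R47 (B); unit res-L1-k25 = res-D-pv-021)

[OURS · L W2.5 · K2.5 support] Kernel witness on res-type-055's R47 (B) carrier SW (`Lem95CoupledCountermodel`, p489606: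
`E = Lem95Coupled.toFin 𝔽 2 εW = Σ_k x₁^{2k} x₂³ ∈ 𝔽₂⟦x₀, x₁, x₂⟧`, `x₀ = y`, `x₁ = ω₁`, `x₂ = ω₂`; `p = 2`, `e = 1`).
The structure theorems of that file, of `Lem95CoupledBox` (p491132) and of the K2.5 files
(`MarkedTransferCampaignW25FiniteRaySW*.lean`) quantify over ALL standard expressions of `E` (row 052a carrier); this
file shows they are not vacuous and supplies the explicit depth-`ℓ` (76)-expansion the kill tests K2.4/K2.5 run on
(res-type-013's blind repro 05:11:30Z at `ℓ = 3`: `U·(ω₂³ + ω₁²ω₂³ + ω₁⁴ω₂³ + ω₁⁶ω₂³)`, `U = (1+ω₁)^{−8}`):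

* `geomSW = Σ_j ω₁^j`, `coefU ℓ = geomSW^{2^ℓ} = Σ_j ω₁^{2^ℓ j}` — a unit of `𝔽₂⟦x⟧` lying in `ρ^ℓ` (`coeff_geomSW_pow`,
  `isUnit_coefU`, `coefU_mem_frobPow`);
* `suppSW ℓ = {(e₂, 0, (0, r, 1)) : r < 2^{ℓ−1}}`;
* `E_eq_sum` — the coefficient identity `E = Σ_{r < 2^{ℓ−1}} x^{e₂ + 2·(0,r,1)} · U_ℓ` (`k = r + 2^{ℓ−1} j`), `ℓ ≥ 1`;
* `stdExprSW rfl ℓ hℓ : StandardExpression 2 X 1 ℓ E` and `nonempty_stdExpr` (the `(hE : E = toFin 𝔽 2 εW)` binder of p489606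
  keeps the index type syntactically `Fin 3`).

Pattern and lemmas after res-type-054's `TopFrontierDepthWitness` (p485478, the 2-variable witness `ε_W`). Nothing here
is a statement of the manuscript [Hironaka2017] (lit key `paper:url-3343fd9e678b`, «under review», D-0012/D-0089).
AI-written; weaker than expert review.
References: H. Hironaka, ms. 2017-03-23, §8.4 p.46 l.29–36, Eq. (76)/(77) p.49 (UNDER ADJUDICATION). [Hironaka2017]
-/

-- `Summit.<Summit>.<Sub>.Theorems` with `Sub = Summit` (single-conjunct summit, D-0017)
set_option linter.dupNamespace false

noncomputable section

namespace Summit.ResolutionOfSingularities.ResolutionOfSingularities.Theorems.CampaignW25.SW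

open MvPowerSeries Finset
open Literature.AlgebraicGeometry.Hironaka2017.S09LLUED
open Literature.AlgebraicGeometry.Hironaka2017.S09LLUED.TopFrontier
open Literature.AlgebraicGeometry.Hironaka2017.S09LLUED.Lem95Coupled
open Literature.AlgebraicGeometry.Hironaka2017.S09LLUED.Lem95CoupledCountermodel
open Literature.AlgebraicGeometry.Hironaka2017.S08UnitMonomial (StandardExpression frobPow)
open Literature.AlgebraicGeometry.Hironaka2017.S07Permissible.Cor720Countermodel (𝔽)

/-- [OURS · L W2.5] `G₁ := Σ_{j ≥ 0} ω₁^j = (1 − ω₁)^{−1} ∈ 𝔽₂⟦x₀, x₁, x₂⟧`. REAL definition (bookkeeping). [folklore] -/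
def geomSW : MvPowerSeries (Fin 3) 𝔽 := fun m => if m 0 = 0 ∧ m 2 = 0 then 1 else 0

/-- [OURS · L W2.5] `U_ℓ := G₁^{2^ℓ} = Σ_j ω₁^{2^ℓ j}` — a unit lying in `ρ^ℓ(𝔽₂⟦x⟧)`. REAL definition (bookkeeping).
[folklore] -/
def coefU (ℓ : ℕ) : MvPowerSeries (Fin 3) 𝔽 := geomSW ^ 2 ^ ℓ

/-- [OURS · L W2.5] The support `{(e₂, 0, (0, r, 1)) : r < 2^{ℓ−1}}` of the depth-`ℓ` expression of `E`.
REAL definition (bookkeeping). [folklore] -/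
def suppSW (ℓ : ℕ) : Finset (ExpTriple 3) :=
  (Finset.range (2 ^ (ℓ - 1))).image fun r =>
    (Finsupp.single 2 1, (0 : Fin 3 →₀ ℕ), r • Finsupp.single 1 1 + Finsupp.single 2 1)

/-- Coefficients of `G₁`. [folklore] -/
theorem coeff_geomSW (m : Fin 3 →₀ ℕ) : coeff m geomSW = if m 0 = 0 ∧ m 2 = 0 then 1 else 0 := by
  rw [coeff_apply]
  rfl

/-- `G₁` has constant term `1`. [folklore] -/
theorem constantCoeff_geomSW : constantCoeff geomSW = 1 := by
  rw [← coeff_zero_eq_constantCoeff_apply, coeff_geomSW, if_pos (by simp)]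

/-- Coefficients of `G₁^{2^s} = Σ_j ω₁^{2^s j}` (Frobenius on `𝔽₂⟦x⟧`). [folklore] -/
theorem coeff_geomSW_pow (s : ℕ) (m : Fin 3 →₀ ℕ) :
    coeff m (geomSW ^ 2 ^ s) = if m 0 = 0 ∧ m 2 = 0 ∧ 2 ^ s ∣ m 1 then 1 else 0 := by
  have hps : 2 ^ s ≠ 0 := pow_ne_zero _ two_ne_zero
  by_cases hdiv : ∀ i, 2 ^ s ∣ m i
  · rw [Literature.RingTheory.MvPowerSeries.eq_smul_mapRange_div_of_forall_dvd hdiv,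
      Literature.RingTheory.MvPowerSeries.coeff_smul_pow_pow, coeff_geomSW]
    have h0 : (2 ^ s • Finsupp.mapRange (fun x => x / 2 ^ s) (Nat.zero_div _) m : Fin 3 →₀ ℕ) 0 =
        2 ^ s * (m 0 / 2 ^ s) := by simp
    have h1 : (2 ^ s • Finsupp.mapRange (fun x => x / 2 ^ s) (Nat.zero_div _) m : Fin 3 →₀ ℕ) 1 =
        2 ^ s * (m 1 / 2 ^ s) := by simp
    have h2 : (2 ^ s • Finsupp.mapRange (fun x => x / 2 ^ s) (Nat.zero_div _) m : Fin 3 →₀ ℕ) 2 =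
        2 ^ s * (m 2 / 2 ^ s) := by simp
    simp only [Finsupp.mapRange_apply, h0, h1, h2]
    by_cases hm : m 0 / 2 ^ s = 0 ∧ m 2 / 2 ^ s = 0
    · rw [if_pos hm, one_pow, if_pos ⟨by rw [hm.1, mul_zero], by rw [hm.2, mul_zero], Dvd.intro _ rfl⟩]
    · rw [if_neg hm, zero_pow hps, if_neg]
      rintro ⟨h0', h2', -⟩
      apply hm
      constructor
      · rcases mul_eq_zero.mp h0' with h' | h'
        · exact absurd h' hps
        · exact h'
      · rcases mul_eq_zero.mp h2' with h' | h'
        · exact absurd h' hps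
        · exact h'
  · rw [Literature.RingTheory.MvPowerSeries.isSupportedOnMultiples_pow 2 geomSW s m (by push Not at hdiv; exact hdiv),
      if_neg]
    rintro ⟨h0, h2, h1⟩
    apply hdiv
    intro i
    fin_cases i
    · simp [h0]
    · exact h1
    · simp [h2]

/-- `U_ℓ` is a unit. [folklore] -/
theorem isUnit_coefU (ℓ : ℕ) : IsUnit (coefU ℓ) :=
  (isUnit_iff_constantCoeff.2 (by rw [constantCoeff_geomSW]; exact isUnit_one)).pow _

/-- `U_ℓ ∈ ρ^ℓ(𝔽₂⟦x⟧)`. [folklore] -/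
theorem coefU_mem_frobPow (ℓ : ℕ) : coefU ℓ ∈ frobPow (MvPowerSeries (Fin 3) 𝔽) 2 ℓ :=
  ⟨geomSW, rfl⟩

/-- Membership in `suppSW`. [folklore] -/
theorem mem_suppSW {ℓ : ℕ} {t : ExpTriple 3} :
    t ∈ suppSW ℓ ↔ ∃ r < 2 ^ (ℓ - 1),
      t = (Finsupp.single 2 1, (0 : Fin 3 →₀ ℕ), r • Finsupp.single 1 1 + Finsupp.single 2 1) := by
  unfold suppSW
  simp only [Finset.mem_image, Finset.mem_range, eq_comm]

/-- `r ↦ (e₂, 0, (0, r, 1))` is injective. [folklore] -/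
theorem suppSW_injective :
    Function.Injective fun r : ℕ =>
      ((Finsupp.single 2 1, (0 : Fin 3 →₀ ℕ), r • Finsupp.single 1 1 + Finsupp.single 2 1) : ExpTriple 3) := by
  intro r r' h
  have h' := congrArg (fun t : ExpTriple 3 => t.2.2 1) h
  have n21 : (1 : Fin 3) ≠ 2 := by decide
  simpa [Finsupp.add_apply, Finsupp.single_eq_of_ne n21] using h'

/-- [OURS · L W2.5] The exponent of the `r`-th summand in digit form: `θ_r = e₂ + 2·0 + 2·(0, r, 1) = (0, 2r, 3)`.
REAL definition (bookkeeping). [folklore] -/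
def thetaSW (r : ℕ) : Fin 3 →₀ ℕ :=
  Finsupp.single 2 1 + 2 • (0 : Fin 3 →₀ ℕ) + 2 ^ 1 • (r • Finsupp.single 1 1 + Finsupp.single 2 1)

/-- Coordinates of `θ_r`: `(0, 2r, 3)`. [folklore] -/
theorem thetaSW_apply (r : ℕ) : thetaSW r 0 = 0 ∧ thetaSW r 1 = 2 * r ∧ thetaSW r 2 = 3 := by
  have n01 : (0 : Fin 3) ≠ 1 := by decide
  have n02 : (0 : Fin 3) ≠ 2 := by decide
  have n12 : (1 : Fin 3) ≠ 2 := by decide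
  have n21 : (2 : Fin 3) ≠ 1 := by decide
  refine ⟨?_, ?_, ?_⟩
  · simp [thetaSW, Finsupp.add_apply, Finsupp.single_eq_of_ne n01, Finsupp.single_eq_of_ne n02]
  · simp [thetaSW, Finsupp.add_apply, Finsupp.single_eq_of_ne n12]
  · simp [thetaSW, Finsupp.add_apply, Finsupp.single_eq_of_ne n21]

/-- **Coefficient identity behind the depth-`ℓ` expression**: `E = Σ_{r < 2^{ℓ−1}} x^{(0, 2r, 3)} · U_ℓ` for `ℓ ≥ 1`
(`k = r + 2^{ℓ−1} j` splits `Σ_k ω₁^{2k}` by residues of `k`). [folklore] -/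
theorem E_eq_sum {E : MvPowerSeries (Fin 3) 𝔽} (hE : E = toFin 𝔽 2 εW) {ℓ : ℕ} (hℓ : 1 ≤ ℓ) :
    E = ∑ r ∈ Finset.range (2 ^ (ℓ - 1)), monomial (thetaSW r) (1 : 𝔽) * coefU ℓ := by
  classical
  have hR : 0 < 2 ^ (ℓ - 1) := pow_pos two_pos _
  have hpow : 2 ^ ℓ = 2 * 2 ^ (ℓ - 1) := by rw [← pow_succ', Nat.sub_add_cancel hℓ]
  refine MvPowerSeries.ext fun m => ?_
  rw [hE, coeff_E, map_sum]
  simp only [coeff_monomial_mul, one_mul, coefU, coeff_geomSW_pow]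
  have hθ0 : ∀ r, thetaSW r 0 = 0 := fun r => (thetaSW_apply r).1
  have hθ1 : ∀ r, thetaSW r 1 = 2 * r := fun r => (thetaSW_apply r).2.1
  have hθ2 : ∀ r, thetaSW r 2 = 3 := fun r => (thetaSW_apply r).2.2
  have hle : ∀ r, thetaSW r ≤ m ↔ 2 * r ≤ m 1 ∧ 3 ≤ m 2 := by
    intro r
    constructor
    · intro h
      have h1 := h 1
      have h2 := h 2
      rw [hθ1 r] at h1
      rw [hθ2 r] at h2
      exact ⟨h1, h2⟩
    · rintro ⟨h1, h2⟩ i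
      fin_cases i
      · exact (hθ0 r).le.trans (Nat.zero_le _)
      · exact (hθ1 r).le.trans h1
      · exact (hθ2 r).le.trans h2
  by_cases hm : m 0 = 0 ∧ 2 ∣ m 1 ∧ m 2 = 3
  · -- `m = (0, 2k, 3)`: exactly the summand `r = k mod 2^{ℓ−1}` contributes `1`
    obtain ⟨hm0, ⟨k, hk⟩, hm2⟩ := hm
    rw [if_pos ⟨hm0, ⟨k, hk⟩, hm2⟩]
    rw [Finset.sum_eq_single_of_mem (k % 2 ^ (ℓ - 1)) (Finset.mem_range.2 (Nat.mod_lt _ hR))]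
    · have hrk : k % 2 ^ (ℓ - 1) ≤ k := Nat.mod_le _ _
      rw [if_pos ((hle _).2 ⟨by rw [hk]; exact Nat.mul_le_mul_left _ hrk, hm2.ge⟩), if_pos]
      refine ⟨?_, ?_, ?_⟩
      · simp only [Finsupp.tsub_apply, hθ0, hm0]
      · simp only [Finsupp.tsub_apply, hθ2, hm2, Nat.sub_self]
      · simp only [Finsupp.tsub_apply, hθ1, hk]
        rw [← Nat.mul_sub, hpow, mul_dvd_mul_iff_left (two_ne_zero)]
        exact Nat.dvd_sub_mod k
    · intro r hr hne
      rw [Finset.mem_range] at hr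
      split_ifs with h1 h2
      · exfalso
        apply hne
        obtain ⟨-, -, h2b⟩ := h2
        simp only [Finsupp.tsub_apply, hθ1, hk] at h2b
        have hrk : r ≤ k := by
          have := ((hle r).1 h1).1
          rw [hk] at this
          omega
        rw [← Nat.mul_sub, hpow, mul_dvd_mul_iff_left (two_ne_zero)] at h2b
        obtain ⟨j, hj⟩ := h2b
        have hkj : k = r + 2 ^ (ℓ - 1) * j := by omega
        rw [hkj, Nat.add_mul_mod_self_left, Nat.mod_eq_of_lt hr]
      · rfl
      · rfl
  · -- no summand contributes
    rw [if_neg hm, eq_comm]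
    refine Finset.sum_eq_zero fun r hr => ?_
    split_ifs with h1 h2
    · exfalso
      apply hm
      obtain ⟨h2a, h2c, h2b⟩ := h2
      simp only [Finsupp.tsub_apply, hθ0, hθ1, hθ2] at h2a h2b h2c
      obtain ⟨h1a, h1b⟩ := (hle r).1 h1
      refine ⟨by omega, ?_, by omega⟩
      have hdvd : 2 ∣ m 1 - 2 * r := Dvd.dvd.trans (Dvd.intro _ hpow.symm) h2b
      have hsplit : m 1 = (m 1 - 2 * r) + 2 * r := (Nat.sub_add_cancel h1a).symm
      rw [hsplit]
      exact dvd_add hdvd (dvd_mul_right _ _)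
    · rfl
    · rfl

/-- **The depth-`ℓ` standard expression of `E`** (`ℓ ≥ 1`; row-052a carrier, `x = (X₀, X₁, X₂)`, `p = 2`, `e = 1`):
`E = Σ_{r < 2^{ℓ−1}} ω₂ · x^{2·(0,r,1)} · U_ℓ`, all coefficients the same `ρ^ℓ`-unit `U_ℓ = (Σ_j ω₁^j)^{2^ℓ}`.
[folklore] -/
def stdExprSW {E : MvPowerSeries (Fin 3) 𝔽} (hE : E = toFin 𝔽 2 εW) (ℓ : ℕ) (hℓ : 1 ≤ ℓ) :
    StandardExpression 2 (MvPowerSeries.X : Fin 3 → MvPowerSeries (Fin 3) 𝔽) 1 ℓ E where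
  support := suppSW ℓ
  u := fun _ => coefU ℓ
  u_mem := fun _ _ => coefU_mem_frobPow ℓ
  u_unit_or_zero := fun _ _ => Or.inl (isUnit_coefU ℓ)
  a_lt := by
    intro t ht i
    obtain ⟨r, -, rfl⟩ := mem_suppSW.1 ht
    fin_cases i <;> simp
  b_lt := by
    intro t ht j
    obtain ⟨r, -, rfl⟩ := mem_suppSW.1 ht
    simp
  sum_eq := by
    classical
    unfold suppSW
    rw [Finset.sum_image fun r _ r' _ h => suppSW_injective h]
    refine (E_eq_sum hE hℓ).trans (Finset.sum_congr rfl fun r _ => ?_)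
    exact (summand_eq_monomial_mul 2 1
      ((Finsupp.single 2 1, (0 : Fin 3 →₀ ℕ), r • Finsupp.single 1 1 + Finsupp.single 2 1) : ExpTriple 3)
      (coefU ℓ)).symm

/-- `E` has a standard expression of every depth `ℓ ≥ 1`. [folklore] -/
theorem nonempty_stdExpr {ℓ : ℕ} (hℓ : 1 ≤ ℓ) :
    Nonempty (StandardExpression 2 (MvPowerSeries.X : Fin 3 → MvPowerSeries (Fin 3) 𝔽) 1 ℓ (toFin 𝔽 2 εW)) :=
  ⟨stdExprSW rfl ℓ hℓ⟩

end Summit.ResolutionOfSingularities.ResolutionOfSingularities.Theorems.CampaignW25.SW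

end
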